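import Summits.ABC.IUTFork.Cor312TeamAHonestCensusNodes
import Summits.ABC.IUTFork.Cor312SoundInput
import Summits.ABC.IUTFork.Cor312LogKummerGlobal
import HarnessLib

/-!
# [IUTchIII] Cor. 3.12 — the twenty-node chain is TRANSPARENT to the (xi-f) slot: `Chain ↔ G` for every `G`

Record-only companion (D-0012; one bookkeeping `def` = the slot-parametric reading, otherwise proofs) of
`Cor312TeamAHonestCensus{,Nodes}.lean` (p418084 / p418650, abc-iut-w4-d021). S. Mochizuki, *Inter-universal
Teichmüller theory III*, Cor. 3.12 proof pp. 174–186, Step (xi-f) p. 184 l. 19–29 [cite: Mochizuki2012, III Cor 3.12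
p.184]; claim key DISPUTED (D-0012). TAKES NO SIDE; typed ≠ proved.

`honestReadingAt P C D L A G` is p418084's honest reading of all thirty-six observations with an ARBITRARY proposition
`G` in the (xi-f) slot `constitutesConstruction` (everything else unchanged: rows A-1…A-5 readings, (xi-g) ↦
`A.out A.qIn = P.possibleImages`). THEOREM (`chain_at_iff`): given the node-side inputs (Team B's four Step (x)
discharges, the strip slot, `ThetaFinite`, `|log(q)| > 0`), for EVERY `G : Prop`

    `Chain L (honestReadingAt P C D L A G) ↔ G`.

So c312-2's twenty-node chain, with every other observation read honestly, imposes NO constraint on and draws NO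
support from what is placed at (xi-f): the printed proof's structure around the disputed step is a transparent
container in the kernel. Instances recorded: `G := A.GapGlobal` (LEVEL 0 — recovers p418084/p418650:
`honestReadingAt_gapGlobal`), `G := Cor312Vol.SoundAtInput P Glue` (LEVEL 1, row G-c312-9-1 as filed),
`G := Cor312Vol.GlobalVolumeTransport P` (Team B's global input, G-c312-11-1), `G := P.Statement` (the identity edge
of w4-d018's probe), and `G := False` (the chain FAILS exactly at (xi-f): `not_chain_at_false`). This is the sharpest
kernel form of plan/ADJUDICATION-SPEC §2 (G1″) «G-LOCALISED»: the adjudication of the printed proof reduces, over the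
frozen definitions, to the adjudication of the single proposition put in the (xi-f) slot — and by
`InputStrip.gapGlobal_iff_statement` the print-faithful choice there is the Corollary's own inequality.
-/

namespace Summit.ABC

namespace IUTFork

namespace Cor312Proof

open Locus Obs Thm311 Cor312 Cor312Vol StepXI Literature.IUT.LogThetaLattice

variable {T : ThetaIndex} {S : Situation T} (P : Cor312.Setting S)

/-- **The slot-parametric honest reading**: p418084's `honestReading` with an arbitrary proposition `G` at (xi-f)'s
`constitutesConstruction`. Bookkeeping `def`; asserts nothing. [claim: Mochizuki2012, status: disputed] -/
@[claim "Mochizuki2012" "disputed"] def honestReadingAt (C : Column S.L) (D : ThetaLinkStrips P.LogLink P.Strip) (L : Locus → Prop)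
    (A : InputStrip.StripAlgorithm P) (G : Prop) : Obs → Prop
  -- opening paragraph and Steps (i)–(ix): narrative at this typing level (row A-5), except Step (i)'s gluing datum
  | .restrictToStrips => True
  | .linkSplits => True
  | .valueGroupMapsPilots => Nonempty (LinkGluing P)
  | .unitsSubjectInd12 => True
  | .cyclotomesInsulated => True
  | .singleLinkNecessary => True
  | .verticalShiftSolved => True
  | .unitsRelatedContainers => True
  | .frobeniusLikeRelatedToCoric => True
  | .logKummerViaGaloisEvaluation => True
  | .conjSyncLogLinkCompatible => True
  | .cycRigidityApproaches => True
  | .symmetriesSeparate => True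
  | .symmetriesMultiradial => True
  | .conjugacyIndetResolved => True
  | .fmodTranslation => True
  -- Step (x) (row A-1)
  | .kummerDetachmentInd123 => StepX.KummerDetach P
  | .logvolInvariantInequality => StepX.LogvolCoarse P
  | .logvolLogLinkCompatible => StepX.LogvolLogLink P C
  | .tensorIdentifiesMultZ => StepX.TensorMultZ P
  -- Steps (xi-a)–(xi-c) (row A-2)
  | .linkAsGluing => LinkAsGluing P D (Nonempty (LinkGluing P))
  | .outputSatisfiesIPLSHE => OutputIPLSHE (L .IPL) (L .SHE)
  | .valueGroupLinkFullPolyIso => ValueGroupFullPoly P D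
  | .onlyQualitative => OnlyQualitative
  | .displayXIc => DisplayXIc P D (L .IPL) (L .SHE)
  | .hullGivesVectorBundles => HullComparable P
  -- Steps (xi-d)/(xi-e) (row A-3)
  | .displayXId => P.DisplayXIdReal
  | .comparableObjects => P.ComparableObjectsReal
  | .degreesAsLogVolumes => P.DegreesAsLogVolumesReal
  | .oneColumnLogKummerRectifies => P.OneColumnLogKummerReal
  | .sheMeansFixedValue => P.SheMeansFixedValueReal
  | .displayXIe => P.DisplayXIeReal
  -- the tail (row A-4): THE GAP at (xi-f), the strip-algorithm identity at (xi-g), (xi-h), (xii)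
  | .constitutesConstruction => G
  | .twoEquivalentWays => A.out A.qIn = P.possibleImages
  | .noNthPower => ∃ V : Volumes, V.Cor312 ∧ V.negLogTheta = ((-1 : ℝ) : WithTop ℝ) ∧ ¬ (V.negAbsLogq ≤ 2 * (-1))
  | .globalFrobenioidsNeeded => True


variable {P}

/-- At `G := A.GapGlobal` the slot-parametric reading IS p418084's honest reading. [folklore] -/
theorem honestReadingAt_gapGlobal (C : Column S.L) (D : ThetaLinkStrips P.LogLink P.Strip) (L : Locus → Prop)
    (A : InputStrip.StripAlgorithm P) : honestReadingAt P C D L A A.GapGlobal = honestReading P C D L A := by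
  funext o; cases o <;> rfl

/-- The slot-parametric reading agrees with row A-3's real readings of (xi-d)/(xi-e). [folklore] -/
theorem agreesXIde_honestReadingAt (C : Column S.L) (D : ThetaLinkStrips P.LogLink P.Strip) (L : Locus → Prop)
    (A : InputStrip.StripAlgorithm P) (G : Prop) : P.AgreesXIde (honestReadingAt P C D L A G) :=
  ⟨Iff.rfl, Iff.rfl, Iff.rfl, Iff.rfl, Iff.rfl, Iff.rfl⟩

/-- **Nineteen nodes hold under the slot-parametric reading, WHATEVER `G` is** — no node other than (xi-f) reads the
(xi-f) slot ((xi-g) uses `constitutesConstruction` only as a premise it does not need: its conclusion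
`A.out A.qIn = P.possibleImages` is a theorem). [claim: Mochizuki2012, status: disputed] -/
theorem holds_at_of_ne_xi_f (C : Column S.L) (D : ThetaLinkStrips P.LogLink P.Strip) (L : Locus → Prop)
    (A : InputStrip.StripAlgorithm P) (G : Prop)
    (hIndAdm : ∀ Φ ∈ S.L.Ind1Family ∪ S.L.Ind2Family, ∀ (j : T.Label) (vQ : T.VQ)
      (X : Set (S.L.Packet j vQ)), (S.D P.n).Adm j vQ X ↔ (S.D P.n).Adm j vQ (Φ j vQ '' X))
    (hIndVol : (S.D P.n).LogvolInvariant)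
    (hMono : ∀ (j : T.Label) (vQ : T.VQ) (X Y : Set (S.L.Packet j vQ)),
      (S.D P.n).Adm j vQ X → (S.D P.n).Adm j vQ Y → X ⊆ Y →
        (S.D P.n).logvol j vQ X ≤ (S.D P.n).logvol j vQ Y)
    (hKumA : C.KummerA (S.D P.n))
    (hNE : ∀ n m : ℤ, Nonempty (P.IsoS (D.stripLGP (P.lattice.logLink n (m - 1)))
      (D.stripDelta (P.lattice.theater (n + 1) m))))
    (hfin : P.ThetaFinite) (hq : P.AbsLogQPos)
    (s : Step) (hs : s ≠ .xi_f) : s.Holds L (honestReadingAt P C D L A G) := by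
  cases s
  case wlog => exact wlog_holds_of trivial
  case i => exact i_holds_of trivial (PreX.linkGluing_nonempty P)
  case ii => exact ii_holds_of trivial trivial
  case iii => exact iii_holds_of trivial
  case iv => exact iv_holds_of fun _ => trivial
  case v => exact v_holds_of fun _ => ⟨trivial, trivial⟩
  case vi => exact vi_holds_of fun _ => ⟨trivial, trivial, trivial⟩
  case vii => exact vii_holds_of fun _ => ⟨trivial, trivial⟩
  case viii => exact viii_holds_of fun _ => trivial
  case ix => exact ix_holds_of fun _ _ => trivial
  case x =>
    exact stepX_holds P C (fun _ _ => hIndAdm) (fun _ _ _ => hIndVol) (fun _ => hMono) (fun _ => hKumA)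
      (fun h => h) (fun h => h) (fun h => h) (fun h => h)
  case xi_a => exact stepXIa_holds P D (VG := Nonempty (LinkGluing P)) (fun h => h) hNE (fun h => h)
  case xi_b =>
    exact stepXIb_holds P D (CIPL := L .IPL) (CSHE := L .SHE) (fun h => h) (fun h => h) (fun h => h)
      (fun h => h) (fun h => h)
  case xi_c => exact stepXIc_holds P D (CIPL := L .IPL) (CSHE := L .SHE) (fun h => h) (fun h => h) (fun h => h)
  case xi_d => exact Cor312.Setting.stepXId_holds_of (agreesXIde_honestReadingAt C D L A G) hfin hq L
  case xi_e => exact Cor312.Setting.stepXIe_holds (agreesXIde_honestReadingAt C D L A G) L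
  case xi_f => exact absurd rfl hs
  case xi_g => exact xi_g_holds_iff.2 fun _ _ => A.out_qIn
  case xi_h => exact xi_h_holds_of nthPower_not_formal
  case xii => exact xii_holds_of trivial

/-- **Node (xi-f) under the slot-parametric reading holds IFF `G`** (given `ThetaFinite ∧ AbsLogQPos`, under which
(xi-e)'s two honest outputs are theorems). [claim: Mochizuki2012, status: disputed] -/
theorem xi_f_holds_at_iff (C : Column S.L) (D : ThetaLinkStrips P.LogLink P.Strip) (L : Locus → Prop)
    (A : InputStrip.StripAlgorithm P) (G : Prop) (hfin : P.ThetaFinite) (hq : P.AbsLogQPos) :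
    Step.xi_f.Holds L (honestReadingAt P C D L A G) ↔ G :=
  xi_f_holds_iff.trans
    ⟨fun h => h (P.displayXIeReal_of_comparableObjectsReal (P.comparableObjectsReal_iff.mpr ⟨hfin, hq⟩))
        P.sheMeansFixedValueReal_holds,
      fun h _ _ => h⟩

/-- **THE CHAIN IS TRANSPARENT TO THE (xi-f) SLOT: `Chain ↔ G` for every proposition `G`** (given the node-side
inputs). The twenty-node structure of the printed proof neither constrains nor supports what is placed at the
disputed step. [claim: Mochizuki2012, status: disputed] -/
theorem chain_at_iff (C : Column S.L) (D : ThetaLinkStrips P.LogLink P.Strip) (L : Locus → Prop)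
    (A : InputStrip.StripAlgorithm P) (G : Prop)
    (hIndAdm : ∀ Φ ∈ S.L.Ind1Family ∪ S.L.Ind2Family, ∀ (j : T.Label) (vQ : T.VQ)
      (X : Set (S.L.Packet j vQ)), (S.D P.n).Adm j vQ X ↔ (S.D P.n).Adm j vQ (Φ j vQ '' X))
    (hIndVol : (S.D P.n).LogvolInvariant)
    (hMono : ∀ (j : T.Label) (vQ : T.VQ) (X Y : Set (S.L.Packet j vQ)),
      (S.D P.n).Adm j vQ X → (S.D P.n).Adm j vQ Y → X ⊆ Y →
        (S.D P.n).logvol j vQ X ≤ (S.D P.n).logvol j vQ Y)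
    (hKumA : C.KummerA (S.D P.n))
    (hNE : ∀ n m : ℤ, Nonempty (P.IsoS (D.stripLGP (P.lattice.logLink n (m - 1)))
      (D.stripDelta (P.lattice.theater (n + 1) m))))
    (hfin : P.ThetaFinite) (hq : P.AbsLogQPos) :
    Chain L (honestReadingAt P C D L A G) ↔ G :=
  ⟨fun h => (xi_f_holds_at_iff C D L A G hfin hq).mp (h .xi_f),
    fun hg s => by
      by_cases hs : s = .xi_f
      · subst hs; exact (xi_f_holds_at_iff C D L A G hfin hq).mpr hg
      · exact holds_at_of_ne_xi_f C D L A G hIndAdm hIndVol hMono hKumA hNE hfin hq s hs⟩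

/-- Instance `G := False`: **the chain fails EXACTLY at (xi-f)** — with nothing granted at the disputed step the
twenty-node chain does not hold, while its nineteen other nodes still do (`holds_at_of_ne_xi_f`). [folklore] -/
theorem not_chain_at_false (C : Column S.L) (D : ThetaLinkStrips P.LogLink P.Strip) (L : Locus → Prop)
    (A : InputStrip.StripAlgorithm P) (hfin : P.ThetaFinite) (hq : P.AbsLogQPos) :
    ¬ Chain L (honestReadingAt P C D L A False) :=
  fun h => (xi_f_holds_at_iff C D L A False hfin hq).mp (h .xi_f)

/-- Instance `G := P.Statement` (the identity edge): the chain holds IFF the Corollary itself. [folklore] -/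
theorem chain_at_statement_iff (C : Column S.L) (D : ThetaLinkStrips P.LogLink P.Strip) (L : Locus → Prop)
    (A : InputStrip.StripAlgorithm P)
    (hIndAdm : ∀ Φ ∈ S.L.Ind1Family ∪ S.L.Ind2Family, ∀ (j : T.Label) (vQ : T.VQ)
      (X : Set (S.L.Packet j vQ)), (S.D P.n).Adm j vQ X ↔ (S.D P.n).Adm j vQ (Φ j vQ '' X))
    (hIndVol : (S.D P.n).LogvolInvariant)
    (hMono : ∀ (j : T.Label) (vQ : T.VQ) (X Y : Set (S.L.Packet j vQ)),
      (S.D P.n).Adm j vQ X → (S.D P.n).Adm j vQ Y → X ⊆ Y →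
        (S.D P.n).logvol j vQ X ≤ (S.D P.n).logvol j vQ Y)
    (hKumA : C.KummerA (S.D P.n))
    (hNE : ∀ n m : ℤ, Nonempty (P.IsoS (D.stripLGP (P.lattice.logLink n (m - 1)))
      (D.stripDelta (P.lattice.theater (n + 1) m))))
    (hfin : P.ThetaFinite) (hq : P.AbsLogQPos) :
    Chain L (honestReadingAt P C D L A P.Statement) ↔ P.Statement :=
  chain_at_iff C D L A P.Statement hIndAdm hIndVol hMono hKumA hNE hfin hq

/-- Instance `G := Cor312Vol.SoundAtInput P Glue` (LEVEL 1, GAP-LEDGER row G-c312-9-1 as filed): the chain holds IFF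
LEVEL 1 — which then gives the `Statement` by `Cor312Vol.statement_of_soundAtInput`. [claim: Mochizuki2012, status: disputed] -/
theorem chain_at_soundAtInput_iff (C : Column S.L) (D : ThetaLinkStrips P.LogLink P.Strip) (L : Locus → Prop)
    (A : InputStrip.StripAlgorithm P) (Glue : LinkGluing P)
    (hIndAdm : ∀ Φ ∈ S.L.Ind1Family ∪ S.L.Ind2Family, ∀ (j : T.Label) (vQ : T.VQ)
      (X : Set (S.L.Packet j vQ)), (S.D P.n).Adm j vQ X ↔ (S.D P.n).Adm j vQ (Φ j vQ '' X))
    (hIndVol : (S.D P.n).LogvolInvariant)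
    (hMono : ∀ (j : T.Label) (vQ : T.VQ) (X Y : Set (S.L.Packet j vQ)),
      (S.D P.n).Adm j vQ X → (S.D P.n).Adm j vQ Y → X ⊆ Y →
        (S.D P.n).logvol j vQ X ≤ (S.D P.n).logvol j vQ Y)
    (hKumA : C.KummerA (S.D P.n))
    (hNE : ∀ n m : ℤ, Nonempty (P.IsoS (D.stripLGP (P.lattice.logLink n (m - 1)))
      (D.stripDelta (P.lattice.theater (n + 1) m))))
    (hfin : P.ThetaFinite) (hq : P.AbsLogQPos) :
    Chain L (honestReadingAt P C D L A (SoundAtInput P Glue)) ↔ SoundAtInput P Glue :=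
  chain_at_iff C D L A _ hIndAdm hIndVol hMono hKumA hNE hfin hq

/-- Instance `G := Cor312Vol.GlobalVolumeTransport P` (TEAM B's global (xi-g) input, row G-c312-11-1): the chain holds
IFF that input — which then gives the `Statement` by `GlobalVolumeTransport.statement_of` (under `ThetaRegionsAdm`).
[claim: Mochizuki2012, status: disputed] -/
theorem chain_at_globalVolumeTransport_iff (C : Column S.L) (D : ThetaLinkStrips P.LogLink P.Strip)
    (L : Locus → Prop) (A : InputStrip.StripAlgorithm P)
    (hIndAdm : ∀ Φ ∈ S.L.Ind1Family ∪ S.L.Ind2Family, ∀ (j : T.Label) (vQ : T.VQ)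
      (X : Set (S.L.Packet j vQ)), (S.D P.n).Adm j vQ X ↔ (S.D P.n).Adm j vQ (Φ j vQ '' X))
    (hIndVol : (S.D P.n).LogvolInvariant)
    (hMono : ∀ (j : T.Label) (vQ : T.VQ) (X Y : Set (S.L.Packet j vQ)),
      (S.D P.n).Adm j vQ X → (S.D P.n).Adm j vQ Y → X ⊆ Y →
        (S.D P.n).logvol j vQ X ≤ (S.D P.n).logvol j vQ Y)
    (hKumA : C.KummerA (S.D P.n))
    (hNE : ∀ n m : ℤ, Nonempty (P.IsoS (D.stripLGP (P.lattice.logLink n (m - 1)))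
      (D.stripDelta (P.lattice.theater (n + 1) m))))
    (hfin : P.ThetaFinite) (hq : P.AbsLogQPos) :
    Chain L (honestReadingAt P C D L A (GlobalVolumeTransport P)) ↔ GlobalVolumeTransport P :=
  chain_at_iff C D L A _ hIndAdm hIndVol hMono hKumA hNE hfin hq

end Cor312Proof

end IUTFork

end Summit.ABC
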